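import Summits.AtomisticToContinuum.HydrodynamicLimit.Theses.AntiMazurCoboundaries
import Literature.Analysis.FluidPDE.LocalForecastCorrector

/-!
# The defect split: error corrector on bad particles, Hölder in three groups

Route `AntiMazurCoboundaries` of `AtomisticToContinuum/HydrodynamicLimit`, support item
stmt-AtomisticToContinuum-13917 (`LocalCertificateTransfer`), plan step (3). Helper lemmas (`--supports`),
deterministic (pathwise) and valid for every flow structure:

* `ForecastError.abs_integral_fejer_mul_le` — `|∫₀ᴴ (1 − t/H) φ(t) dt| ≤ (H/2)·C` for `|φ| ≤ C`, `0 ≤ H`.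
* `ForecastError.abs_localForecastCorrector_sub_true_le` — the ERROR CORRECTOR
  `E = W_{R,H} − W^{true}_H` between the local forecast corrector
  `W_{R,H}(z) = −∑ᵢ ∫₀ᴴ (1 − t/H) f(ζ^{(i,R)}_t(z)) dt` (tree: `localForecastCorrector`) and the true-flow Fejér
  corrector `W^{true}_H(z) = −∑ᵢ ∫₀ᴴ (1 − t/H) f((Φ_t z)ᵢ) dt` satisfies `|E(z)| ≤ H·C·#bad(z)`, where a
  particle is BAD iff its true state differs from its range-`R` forecast at some time of `[0, H]`
  (verbatim the event of the crux `InfluenceLocality`): good particles contribute nothing, bad ones at most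
  `2·(H/2)·C`.
* `ForecastError.abs_errorQuotient_le` — hence the lag-`s` difference quotient of `E` along the flow is
  bounded by `(H·C/s)·(#bad(Φ_s z) + #bad(z))`.
* `ForecastError.lintegral_exp_add_add_le` — Hölder in three groups (plan step (4)):
  `∫ e^{a+b+c} ≤ (∫ e^{3a})^{1/3} (∫ e^{3b})^{1/3} (∫ e^{3c})^{1/3}`, so the defect pressure of
  `2(S + B − D_E)` splits into the shot-noise, window and error-corrector pressures at amplitude `6`.

References: route docstring of stmt-AtomisticToContinuum-13917, step (3); folklore.
-/

noncomputable section

open MeasureTheory Set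
open scoped Interval

namespace Summit.AtomisticToContinuum.HydrodynamicLimit.Theorems

open Literature.Analysis.FluidPDE (HardSphereFlow Config localForecastCorrector localForecast
  localClusterState)

namespace ForecastError

/-- `|∫₀ᴴ (1 − t/H) φ(t) dt| ≤ (H/2)·C` when `|φ| ≤ C` and `0 ≤ H` (the Fejér weight is nonnegative on
`[0, H]` and integrates to `H/2`). [folklore] -/
theorem abs_integral_fejer_mul_le {φ : ℝ → ℝ} {C H : ℝ} (hH : 0 ≤ H) (hφ : ∀ t, |φ t| ≤ C) :
    |∫ t in (0 : ℝ)..H, (1 - t / H) * φ t| ≤ H / 2 * C := by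
  have hw : ∀ᵐ t ∂(volume : Measure ℝ), t ∈ Set.Ioc 0 H → ‖(1 - t / H) * φ t‖ ≤ (1 - t / H) * C :=
    Filter.Eventually.of_forall fun t ht => by
      have h0 : 0 ≤ 1 - t / H := sub_nonneg.2 (div_le_one_of_le₀ ht.2 hH)
      rw [norm_mul, Real.norm_eq_abs, Real.norm_eq_abs, abs_of_nonneg h0]
      exact mul_le_mul_of_nonneg_left (hφ _) h0
  have h := intervalIntegral.norm_integral_le_of_norm_le hH hw
    ((intervalIntegrable_const.sub (intervalIntegral.intervalIntegrable_id.div_const H)).mul_const C)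
  rw [intervalIntegral.integral_mul_const, Literature.Analysis.FluidPDE.integral_fejerWeight] at h
  simpa [Real.norm_eq_abs] using h

variable {d : Type*} [Fintype d] {X : Type*} [MeasureSpace X] [TopologicalSpace X] {N : ℕ}
  {G : Literature.Analysis.FluidPDE.Geometry d X} {ε : ℝ}

open scoped Classical in
/-- **The error corrector lives on the bad particles.** For a one-body observable `f` with `|f| ≤ C`, a
horizon `0 ≤ H`, a range `R`, any flow map `flow` and any family `Ψ` of cluster flows: the local forecast
corrector differs from the true-flow Fejér corrector by at most `H·C` per BAD particle (one whose true
state differs from its range-`R` forecast at some time of `[0, H]`), good particles contributing nothing.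
[folklore] -/
theorem abs_localForecastCorrector_sub_true_le (Ψ : (k : ℕ) → HardSphereFlow G ε k)
    (flow : ℝ → Config N d X → Config N d X) (R : ℝ) {H : ℝ} (hH : 0 ≤ H)
    {f : X × EuclideanSpace ℝ d → ℝ} {C : ℝ} (hf : ∀ q, |f q| ≤ C) (z : Config N d X) :
    |localForecastCorrector Ψ R H f z -
        (-∑ i, ∫ t in (0 : ℝ)..H, (1 - t / H) * f (flow t z i))| ≤
      H * C * ((Finset.univ.filter fun i : Fin N =>
        ∃ t ∈ Set.Icc (0 : ℝ) H, flow t z i ≠ localClusterState Ψ R t z i).card : ℝ) := by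
  classical
  set bad : Finset (Fin N) := Finset.univ.filter fun i : Fin N =>
    ∃ t ∈ Set.Icc (0 : ℝ) H, flow t z i ≠ localClusterState Ψ R t z i with hbad
  -- per-particle differences
  set dᵢ : Fin N → ℝ := fun i =>
    localForecast Ψ R H f z i - ∫ t in (0 : ℝ)..H, (1 - t / H) * f (flow t z i) with hd
  have hsum : localForecastCorrector Ψ R H f z - (-∑ i, ∫ t in (0 : ℝ)..H, (1 - t / H) * f (flow t z i)) =
      -∑ i, dᵢ i := by
    simp only [localForecastCorrector, hd, Finset.sum_sub_distrib]
    ring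
  -- good particles contribute nothing
  have hgood : ∀ i, i ∉ bad → dᵢ i = 0 := by
    intro i hi
    have hall : ∀ t ∈ Set.Icc (0 : ℝ) H, flow t z i = localClusterState Ψ R t z i := by
      intro t ht
      by_contra hne
      exact hi (Finset.mem_filter.2 ⟨Finset.mem_univ _, t, ht, hne⟩)
    simp only [hd, localForecast, sub_eq_zero]
    refine intervalIntegral.integral_congr fun t ht => ?_
    rw [uIcc_of_le hH] at ht
    simp only [hall t ht]
  -- bad particles contribute at most `H·C`
  have hbadle : ∀ i, |dᵢ i| ≤ H * C := by
    intro i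
    calc |dᵢ i| ≤ |localForecast Ψ R H f z i| + |∫ t in (0 : ℝ)..H, (1 - t / H) * f (flow t z i)| :=
          abs_sub _ _
      _ ≤ H / 2 * C + H / 2 * C :=
          add_le_add (Literature.Analysis.FluidPDE.abs_localForecast_le Ψ R hH hf z i)
            (abs_integral_fejer_mul_le hH fun t => hf _)
      _ = H * C := by ring
  rw [hsum, abs_neg]
  calc |∑ i, dᵢ i| ≤ ∑ i, |dᵢ i| := Finset.abs_sum_le_sum_abs _ _
    _ = ∑ i, if i ∈ bad then |dᵢ i| else 0 := by
        refine Finset.sum_congr rfl fun i _ => ?_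
        split_ifs with hi
        · rfl
        · rw [hgood i hi, abs_zero]
    _ = ∑ i ∈ bad, |dᵢ i| := by
        rw [← Finset.sum_filter]
        congr 1
        ext i
        simp
    _ ≤ ∑ _i ∈ bad, H * C := Finset.sum_le_sum fun i _ => hbadle i
    _ = H * C * (bad.card : ℝ) := by
        rw [Finset.sum_const, nsmul_eq_mul]
        ring

open scoped Classical in
/-- **The difference quotient of the error corrector along the flow** is carried by the bad particles at
the two ends of the lag: with `E = W_{R,H} − W^{true}_H` as above and any `s > 0`,
`|s⁻¹ (E(Φ_s z) − E(z))| ≤ (H·C/s)·(#bad(Φ_s z) + #bad(z))`. [folklore] -/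
theorem abs_errorQuotient_le (Ψ : (k : ℕ) → HardSphereFlow G ε k)
    (flow : ℝ → Config N d X → Config N d X) (R : ℝ) {H : ℝ} (hH : 0 ≤ H)
    {f : X × EuclideanSpace ℝ d → ℝ} {C : ℝ} (hf : ∀ q, |f q| ≤ C) {s : ℝ} (hs : 0 < s)
    (E : Config N d X → ℝ)
    (hE : ∀ x, E x = localForecastCorrector Ψ R H f x -
      (-∑ i, ∫ t in (0 : ℝ)..H, (1 - t / H) * f (flow t x i)))
    (z : Config N d X) :
    |s⁻¹ * (E (flow s z) - E z)| ≤
      H * C / s * (((Finset.univ.filter fun i : Fin N =>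
          ∃ t ∈ Set.Icc (0 : ℝ) H, flow t (flow s z) i ≠ localClusterState Ψ R t (flow s z) i).card : ℝ) +
        ((Finset.univ.filter fun i : Fin N =>
          ∃ t ∈ Set.Icc (0 : ℝ) H, flow t z i ≠ localClusterState Ψ R t z i).card : ℝ)) := by
  have h1 := abs_localForecastCorrector_sub_true_le Ψ flow R hH hf (flow s z)
  have h2 := abs_localForecastCorrector_sub_true_le Ψ flow R hH hf z
  rw [← hE] at h1 h2
  rw [abs_mul, abs_inv, abs_of_pos hs]
  calc s⁻¹ * |E (flow s z) - E z| ≤ s⁻¹ * (|E (flow s z)| + |E z|) :=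
        mul_le_mul_of_nonneg_left (abs_sub _ _) (inv_nonneg.2 hs.le)
    _ ≤ s⁻¹ * (H * C * _ + H * C * _) := mul_le_mul_of_nonneg_left (add_le_add h1 h2) (inv_nonneg.2 hs.le)
    _ = _ := by ring

/-! ## Hölder in three groups (plan step (4): "amplitude 6 each") -/

/-- **Hölder split of an exponential moment into three groups**: for a.e.-measurable real `a, b, c`,
`∫ exp(a + b + c) dμ ≤ (∫ exp(3a) dμ)^{1/3} (∫ exp(3b) dμ)^{1/3} (∫ exp(3c) dμ)^{1/3}` (generalised Hölder
with exponents `(1/3, 1/3, 1/3)`; with `a + b + c = 2(S + B − D_E)` the three factors have amplitude `6`).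
[folklore] -/
theorem lintegral_exp_add_add_le {Y : Type*} [MeasurableSpace Y] (μ : Measure Y) {a b c : Y → ℝ}
    (ha : AEMeasurable a μ) (hb : AEMeasurable b μ) (hc : AEMeasurable c μ) :
    ∫⁻ x, ENNReal.ofReal (Real.exp (a x + b x + c x)) ∂μ ≤
      (∫⁻ x, ENNReal.ofReal (Real.exp (3 * a x)) ∂μ) ^ (1 / 3 : ℝ) *
        (∫⁻ x, ENNReal.ofReal (Real.exp (3 * b x)) ∂μ) ^ (1 / 3 : ℝ) *
        (∫⁻ x, ENNReal.ofReal (Real.exp (3 * c x)) ∂μ) ^ (1 / 3 : ℝ) := by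
  set f : Fin 3 → Y → ENNReal := ![fun x => ENNReal.ofReal (Real.exp (3 * a x)),
    fun x => ENNReal.ofReal (Real.exp (3 * b x)), fun x => ENNReal.ofReal (Real.exp (3 * c x))] with hf
  have hmk : ∀ {g : Y → ℝ}, AEMeasurable g μ →
      AEMeasurable (fun x => ENNReal.ofReal (Real.exp (3 * g x))) μ := fun hg =>
    (Real.measurable_exp.comp_aemeasurable (hg.const_mul 3)).ennreal_ofReal
  have hfm : ∀ i ∈ (Finset.univ : Finset (Fin 3)), AEMeasurable (f i) μ := by
    intro i _
    fin_cases i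
    · exact hmk ha
    · exact hmk hb
    · exact hmk hc
  have hp : ∑ i ∈ (Finset.univ : Finset (Fin 3)), (fun _ : Fin 3 => (1 / 3 : ℝ)) i = 1 := by
    rw [Finset.sum_const, Finset.card_univ, Fintype.card_fin]
    norm_num
  have h := ENNReal.lintegral_prod_norm_pow_le Finset.univ hfm hp (fun _ _ => by norm_num)
  -- `(e^{3g})^{1/3} = e^{g}`
  have hroot : ∀ g : ℝ, ENNReal.ofReal (Real.exp (3 * g)) ^ (1 / 3 : ℝ) = ENNReal.ofReal (Real.exp g) := by
    intro g
    rw [ENNReal.ofReal_rpow_of_nonneg (Real.exp_pos _).le (by norm_num), ← Real.exp_mul]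
    congr 2
    ring
  have hint : ∀ x, ∏ i ∈ (Finset.univ : Finset (Fin 3)), f i x ^ (fun _ : Fin 3 => (1 / 3 : ℝ)) i =
      ENNReal.ofReal (Real.exp (a x + b x + c x)) := by
    intro x
    rw [Fin.prod_univ_three]
    simp only [hf, Matrix.cons_val_zero, Matrix.cons_val_one, Matrix.cons_val_two, Matrix.head_cons,
      Matrix.tail_cons, hroot]
    rw [← ENNReal.ofReal_mul (Real.exp_pos _).le, ← ENNReal.ofReal_mul (by positivity), ← Real.exp_add,
      ← Real.exp_add]
  have hrhs : ∏ i ∈ (Finset.univ : Finset (Fin 3)), (∫⁻ x, f i x ∂μ) ^ (fun _ : Fin 3 => (1 / 3 : ℝ)) i =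
      (∫⁻ x, ENNReal.ofReal (Real.exp (3 * a x)) ∂μ) ^ (1 / 3 : ℝ) *
        (∫⁻ x, ENNReal.ofReal (Real.exp (3 * b x)) ∂μ) ^ (1 / 3 : ℝ) *
        (∫⁻ x, ENNReal.ofReal (Real.exp (3 * c x)) ∂μ) ^ (1 / 3 : ℝ) := by
    rw [Fin.prod_univ_three]
    simp only [hf, Matrix.cons_val_zero, Matrix.cons_val_one, Matrix.cons_val_two, Matrix.head_cons,
      Matrix.tail_cons]
  calc ∫⁻ x, ENNReal.ofReal (Real.exp (a x + b x + c x)) ∂μ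
      = ∫⁻ x, ∏ i ∈ (Finset.univ : Finset (Fin 3)), f i x ^ (fun _ : Fin 3 => (1 / 3 : ℝ)) i ∂μ :=
        lintegral_congr fun x => (hint x).symm
    _ ≤ _ := h
    _ = _ := hrhs

end ForecastError

end Summit.AtomisticToContinuum.HydrodynamicLimit.Theorems

end
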